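import Literature.MathematicalPhysics.QuantumLattice.MagneticHubbardTorusGauge
import Literature.MathematicalPhysics.QuantumLattice.ApproximateEigenvectorLemmas
import Literature.MathematicalPhysics.QuantumLattice.HubbardGaugeBound
import HarnessLib

/-!
# The magnetic Hubbard torus relative to the trivial field: Peierls unfolding in expectation

Topic `Literature/MathematicalPhysics/QuantumLattice` (family `hubbard`); companion of
`MagneticHubbardTorus.lean` / `MagneticHubbardTorusGauge.lean`. Everything here is PROVED; no
definitions, no named facts.

## Contents

* `magneticHubbardTorus_eq_one_add` — `H_A(t,U) = H_1(t,U) − t Σ_{x,i,σ} [(a_{x,i} − 1) c†_{x+eᵢ,σ}c_{x,σ}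
  + (conj a_{x,i} − 1) c†_{x,σ}c_{x+eᵢ,σ}]` (the interaction does not see the field);
* `re_star_dotProduct_magneticHubbardTorus_mulVec` — the same in expectation at `t = 1`:
  `Re⟨φ, H_A φ⟩ = Re⟨φ, H_1 φ⟩ + Σ_{x,i,σ} [2(1 − Re a_{x,i}) Re h_{x,i,σ}(φ) + 2 Im a_{x,i} · Im h_{x,i,σ}(φ)]`,
  `h_{x,i,σ}(φ) = ⟨φ, c†_{x+eᵢ,σ} c_{x,σ} φ⟩` (bond kinetic weight `2 Re h`, bond current `−2 Im h`);
* `re_star_dotProduct_magneticHubbardTorus_uniformTwistConfig_mulVec` — the uniform twist `e^{iθ/L}`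
  on the `e₁`-bonds: `Re⟨φ, H_θ φ⟩ = Re⟨φ, H_1 φ⟩ + 2(1 − cos(θ/L)) Σ_{x,σ} Re h_{x,0,σ} + 2 sin(θ/L) Σ_{x,σ} Im h_{x,0,σ}`
  (Watanabe 2019 §2.2.1, the expansion of `U_m† H U_m`);
* `norm_star_dotProduct_creation_mul_annihilation_mulVec_le` — `|⟨φ, c†_p c_q φ⟩| ≤ 1` for a unit
  vector (`‖c†‖, ‖c‖ ≤ 1`), and the resulting bound `|Σ_{x,σ} Re h_{x,0,σ}| ≤ 2L²`
  (`abs_sum_re_hop_le`).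

## References

* E. H. Lieb, PRL 73 (1994) 2158, eq. (1) (Peierls substitution). [Lieb1994]
* H. Watanabe, J. Stat. Phys. 177 (2019) 717, §2.2.1 eqs. (13)–(16) (energy of the twisted state to
  second order: kinetic term `(1 − cos)` and current term `sin`). [Watanabe2019]
* D. Bohm, Phys. Rev. 75 (1949) 502 (Bloch's variational argument). [Bohm1949]
-/

noncomputable section

namespace Literature.MathematicalPhysics.QuantumLattice

open Matrix Finset Literature.MathematicalPhysics.QuantumFieldTheory
open scoped ComplexConjugate Matrix.Norms.L2Operator

/-! ### Two scalar facts -/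

/-- `Re(−[(a − 1) h + (conj a − 1) conj h]) = 2(1 − Re a) Re h + 2 Im a · Im h`. [folklore] -/
theorem re_neg_one_mul_peierls (a h : ℂ) :
    (-1 * ((a - 1) * h + (conj a - 1) * (starRingEnd ℂ) h)).re =
      2 * (1 - a.re) * h.re + 2 * a.im * h.im := by
  simp only [Complex.mul_re, Complex.add_re, Complex.add_im, Complex.mul_im, Complex.sub_re,
    Complex.sub_im, Complex.conj_re, Complex.conj_im, Complex.one_re, Complex.one_im,
    Complex.neg_re, Complex.neg_im]
  ring

section Hops

variable {Λ : Type*} [LinearOrder Λ] [Fintype Λ]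

/-- The reversed hop has the conjugate expectation: `⟨φ, c†_q c_p φ⟩ = conj ⟨φ, c†_p c_q φ⟩`
(`(c†_p c_q)ᴴ = c†_q c_p`). Bratteli–Robinson II §5.2.2. [folklore] -/
theorem star_dotProduct_creation_mul_annihilation_mulVec_swap (p q : Λ) (φ : Fock Λ) :
    star φ ⬝ᵥ ((creation q * annihilation p) *ᵥ φ) =
      (starRingEnd ℂ) (star φ ⬝ᵥ ((creation p * annihilation q) *ᵥ φ)) := by
  rw [← conjTranspose_creation_mul_annihilation p q, star_dotProduct_conjTranspose_mulVec_eq_star,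
    Complex.star_def]

/-- **A hopping amplitude in a unit vector has modulus at most one**: `|⟨φ, c†_p c_q φ⟩| ≤ 1`
(operator norms `‖c†_p‖, ‖c_q‖ ≤ 1`, `norm_creation_le_one` / `norm_annihilation_le_one`).
Bratteli–Robinson II, Prop. 5.2.2 (`‖a(f)‖ = ‖f‖`). [folklore] -/
theorem norm_star_dotProduct_creation_mul_annihilation_mulVec_le {φ : Fock Λ}
    (hφ : star φ ⬝ᵥ φ = 1) (p q : Λ) :
    ‖star φ ⬝ᵥ ((creation p * annihilation q) *ᵥ φ)‖ ≤ 1 := by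
  refine (norm_star_dotProduct_le_eucNorm hφ _).trans ?_
  refine (eucNorm_mulVec_le _ _).trans ?_
  rw [eucNorm_eq_one hφ, mul_one]
  refine (l2_opNorm_mul _ _).trans ?_
  exact mul_le_one₀ (norm_creation_le_one _) (norm_nonneg _) (norm_annihilation_le_one _)

/-- Hence `|Re⟨φ, c†_p c_q φ⟩| ≤ 1` for a unit vector. [folklore] -/
theorem abs_re_star_dotProduct_creation_mul_annihilation_mulVec_le {φ : Fock Λ}
    (hφ : star φ ⬝ᵥ φ = 1) (p q : Λ) :
    |(star φ ⬝ᵥ ((creation p * annihilation q) *ᵥ φ)).re| ≤ 1 :=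
  (Complex.abs_re_le_norm _).trans (norm_star_dotProduct_creation_mul_annihilation_mulVec_le hφ p q)

end Hops

/-! ### The Peierls Hamiltonian relative to the trivial field -/

section Torus

variable {L : ℕ} [NeZero L]

/-- **Peierls unfolding, operator level**: `H_A(t,U) = H_1(t,U) − t Σ_{x,i,σ} [(a_{x,i} − 1) c†_{x+eᵢ,σ}c_{x,σ}
+ (conj a_{x,i} − 1) c†_{x,σ}c_{x+eᵢ,σ}]` (the interaction is field independent). Lieb, PRL 73 (1994)
2158, eq. (1). [cite: Lieb1994, eq. (1)] -/
theorem magneticHubbardTorus_eq_one_add (A : GaugeConfig 2 L Circle) (t U : ℝ) :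
    magneticHubbardTorus L A t U = magneticHubbardTorus L 1 t U +
      (-(t : ℂ)) • ∑ x : Site 2 L, ∑ i : Fin 2, ∑ σ : Fin 2,
        ((((A (x, i) : Circle) : ℂ) - 1) •
            (creation (orb (FermionTorus.ofTorusSite (Site.shift x i)) σ) *
              annihilation (orb (FermionTorus.ofTorusSite x) σ)) +
          (conj ((A (x, i) : Circle) : ℂ) - 1) •
            (creation (orb (FermionTorus.ofTorusSite x) σ) *
              annihilation (orb (FermionTorus.ofTorusSite (Site.shift x i)) σ))) := by
  have hS : (∑ x : Site 2 L, ∑ i : Fin 2, ∑ σ : Fin 2,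
      ((((A (x, i) : Circle) : ℂ)) •
          (creation (orb (FermionTorus.ofTorusSite (Site.shift x i)) σ) *
            annihilation (orb (FermionTorus.ofTorusSite x) σ)) +
        (starRingEnd ℂ) ((A (x, i) : Circle) : ℂ) •
          (creation (orb (FermionTorus.ofTorusSite x) σ) *
            annihilation (orb (FermionTorus.ofTorusSite (Site.shift x i)) σ)) :
        Matrix (Finset (Orb (FermionTorus 2 L))) (Finset (Orb (FermionTorus 2 L))) ℂ)) =
      (∑ x : Site 2 L, ∑ i : Fin 2, ∑ σ : Fin 2,
        (((((1 : GaugeConfig 2 L Circle) (x, i) : Circle) : ℂ)) •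
            (creation (orb (FermionTorus.ofTorusSite (Site.shift x i)) σ) *
              annihilation (orb (FermionTorus.ofTorusSite x) σ)) +
          (starRingEnd ℂ) (((1 : GaugeConfig 2 L Circle) (x, i) : Circle) : ℂ) •
            (creation (orb (FermionTorus.ofTorusSite x) σ) *
              annihilation (orb (FermionTorus.ofTorusSite (Site.shift x i)) σ)))) +
      ∑ x : Site 2 L, ∑ i : Fin 2, ∑ σ : Fin 2,
        ((((A (x, i) : Circle) : ℂ) - 1) •
            (creation (orb (FermionTorus.ofTorusSite (Site.shift x i)) σ) *
              annihilation (orb (FermionTorus.ofTorusSite x) σ)) +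
          (conj ((A (x, i) : Circle) : ℂ) - 1) •
            (creation (orb (FermionTorus.ofTorusSite x) σ) *
              annihilation (orb (FermionTorus.ofTorusSite (Site.shift x i)) σ))) := by
    rw [← Finset.sum_add_distrib]
    refine Finset.sum_congr rfl fun x _ => ?_
    rw [← Finset.sum_add_distrib]
    refine Finset.sum_congr rfl fun i _ => ?_
    rw [← Finset.sum_add_distrib]
    refine Finset.sum_congr rfl fun σ _ => ?_
    simp only [Pi.one_apply, Circle.coe_one, map_one, one_smul, sub_smul]
    abel
  rw [magneticHubbardTorus, magneticHubbardTorus, hS, smul_add]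
  abel

/-- **Peierls unfolding in expectation** (`t = 1`): for every vector `φ`,
`Re⟨φ, H_A φ⟩ = Re⟨φ, H_1 φ⟩ + Σ_{x,i,σ} [2(1 − Re a_{x,i}) Re h_{x,i,σ}(φ) + 2 Im a_{x,i} · Im h_{x,i,σ}(φ)]`
with `h_{x,i,σ}(φ) = ⟨φ, c†_{x+eᵢ,σ} c_{x,σ} φ⟩`: the bond kinetic weights pay `2(1 − Re a)`, the
bond currents pay `−2 Im a`. Lieb, PRL 73 (1994) 2158, eq. (1); Watanabe (2019) §2.2.1 eqs. (13)–(16).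
[cite: Watanabe2019, §2.2.3 and §4.1] -/
theorem re_star_dotProduct_magneticHubbardTorus_mulVec (A : GaugeConfig 2 L Circle) (U : ℝ)
    (φ : Fock (Orb (FermionTorus 2 L))) :
    (star φ ⬝ᵥ (magneticHubbardTorus L A 1 U *ᵥ φ)).re =
      (star φ ⬝ᵥ (magneticHubbardTorus L 1 1 U *ᵥ φ)).re +
        ∑ x : Site 2 L, ∑ i : Fin 2, ∑ σ : Fin 2,
          (2 * (1 - ((A (x, i) : Circle) : ℂ).re) *
              (star φ ⬝ᵥ ((creation (orb (FermionTorus.ofTorusSite (Site.shift x i)) σ) *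
                annihilation (orb (FermionTorus.ofTorusSite x) σ)) *ᵥ φ)).re +
            2 * ((A (x, i) : Circle) : ℂ).im *
              (star φ ⬝ᵥ ((creation (orb (FermionTorus.ofTorusSite (Site.shift x i)) σ) *
                annihilation (orb (FermionTorus.ofTorusSite x) σ)) *ᵥ φ)).im) := by
  rw [magneticHubbardTorus_eq_one_add A 1 U, add_mulVec, dotProduct_add, Complex.add_re, add_right_inj,
    Complex.ofReal_one, smul_mulVec, dotProduct_smul, smul_eq_mul]
  simp only [Matrix.sum_mulVec, dotProduct_sum, Finset.mul_sum, Complex.re_sum]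
  refine Finset.sum_congr rfl fun x _ => Finset.sum_congr rfl fun i _ =>
    Finset.sum_congr rfl fun σ _ => ?_
  rw [add_mulVec, dotProduct_add, smul_mulVec, smul_mulVec, dotProduct_smul,
    dotProduct_smul, smul_eq_mul, smul_eq_mul,
    star_dotProduct_creation_mul_annihilation_mulVec_swap
      (orb (FermionTorus.ofTorusSite (Site.shift x i)) σ) (orb (FermionTorus.ofTorusSite x) σ)]
  exact re_neg_one_mul_peierls _ _

/-- Bookkeeping: `Σ_x [(2c R₀ + 2d I₀) + (2c R₁ + 2d I₁)] = 2c Σ_x (R₀ + R₁) + 2d Σ_x (I₀ + I₁)`.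
[folklore] -/
private theorem sum_two_bonds_rearrange {ι : Type*} (s : Finset ι) (c d : ℝ) (R₀ I₀ R₁ I₁ : ι → ℝ) :
    ∑ x ∈ s, ((2 * c * R₀ x + 2 * d * I₀ x) + (2 * c * R₁ x + 2 * d * I₁ x)) =
      2 * c * ∑ x ∈ s, (R₀ x + R₁ x) + 2 * d * ∑ x ∈ s, (I₀ x + I₁ x) := by
  rw [Finset.mul_sum, Finset.mul_sum, ← Finset.sum_add_distrib]
  exact Finset.sum_congr rfl fun x _ => by ring

/-- **The uniformly twisted torus in expectation**: with the twist `e^{iθ/L}` on every `e₁`-bond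
(`uniformTwistConfig L θ`) and `h_{x,0,σ}(φ) = ⟨φ, c†_{x+e₁,σ} c_{x,σ} φ⟩`,
`Re⟨φ, H_θ φ⟩ = Re⟨φ, H_1 φ⟩ + 2(1 − cos(θ/L)) Σ_{x,σ} Re h_{x,0,σ}(φ) + 2 sin(θ/L) Σ_{x,σ} Im h_{x,0,σ}(φ)`.
Watanabe, J. Stat. Phys. 177 (2019) 717, §2.2.1 eqs. (13)–(16). [cite: Watanabe2019, §2.2.3 and §4.1] -/
theorem re_star_dotProduct_magneticHubbardTorus_uniformTwistConfig_mulVec (θ U : ℝ)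
    (φ : Fock (Orb (FermionTorus 2 L))) :
    (star φ ⬝ᵥ (magneticHubbardTorus L (uniformTwistConfig L θ) 1 U *ᵥ φ)).re =
      (star φ ⬝ᵥ (magneticHubbardTorus L 1 1 U *ᵥ φ)).re +
        2 * (1 - Real.cos (θ / L)) *
          (∑ x : Site 2 L, ∑ σ : Fin 2,
            (star φ ⬝ᵥ ((creation (orb (FermionTorus.ofTorusSite (Site.shift x 0)) σ) *
              annihilation (orb (FermionTorus.ofTorusSite x) σ)) *ᵥ φ)).re) +
        2 * Real.sin (θ / L) *
          (∑ x : Site 2 L, ∑ σ : Fin 2,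
            (star φ ⬝ᵥ ((creation (orb (FermionTorus.ofTorusSite (Site.shift x 0)) σ) *
              annihilation (orb (FermionTorus.ofTorusSite x) σ)) *ᵥ φ)).im) := by
  rw [re_star_dotProduct_magneticHubbardTorus_mulVec, add_assoc, add_right_inj]
  have hcoe : ∀ x : Site 2 L, ((uniformTwistConfig L θ (x, 0) : Circle) : ℂ) =
      Complex.exp (((θ / L : ℝ) : ℂ) * Complex.I) := fun x => by
    rw [uniformTwistConfig_apply, if_pos rfl, Circle.coe_exp]
  have hone : ∀ x : Site 2 L, ((uniformTwistConfig L θ (x, 1) : Circle) : ℂ) = 1 := fun x => by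
    rw [uniformTwistConfig_apply, if_neg (by decide), Circle.coe_one]
  -- expand the sums over `i : Fin 2` (the `e₂`-terms vanish) and over `σ : Fin 2`
  simp only [Fin.sum_univ_two, hcoe, hone, Complex.exp_ofReal_mul_I_re, Complex.exp_ofReal_mul_I_im,
    Complex.one_re, Complex.one_im, sub_self, mul_zero, zero_mul, add_zero]
  exact sum_two_bonds_rearrange _ _ _ _ _ _ _

/-- The `e₁`-kinetic weight of a unit vector is at most the number of its terms:
`|Σ_{x,σ} Re h_{x,0,σ}(φ)| ≤ 2L²`. [folklore] -/
theorem abs_sum_re_hop_le {φ : Fock (Orb (FermionTorus 2 L))} (hφ : star φ ⬝ᵥ φ = 1) :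
    |∑ x : Site 2 L, ∑ σ : Fin 2,
        (star φ ⬝ᵥ ((creation (orb (FermionTorus.ofTorusSite (Site.shift x 0)) σ) *
          annihilation (orb (FermionTorus.ofTorusSite x) σ)) *ᵥ φ)).re| ≤ 2 * (L : ℝ) ^ 2 := by
  refine (Finset.abs_sum_le_sum_abs _ _).trans ?_
  have h : ∀ x ∈ (Finset.univ : Finset (Site 2 L)), |∑ σ : Fin 2,
      (star φ ⬝ᵥ ((creation (orb (FermionTorus.ofTorusSite (Site.shift x 0)) σ) *
        annihilation (orb (FermionTorus.ofTorusSite x) σ)) *ᵥ φ)).re| ≤ 2 := fun x _ => by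
    refine (Finset.abs_sum_le_sum_abs _ _).trans ?_
    refine (Finset.sum_le_sum fun σ _ =>
      abs_re_star_dotProduct_creation_mul_annihilation_mulVec_le hφ _ _).trans ?_
    simp
  refine (Finset.sum_le_sum h).trans ?_
  rw [Finset.sum_const, Finset.card_univ, nsmul_eq_mul]
  have hcard : (Fintype.card (Site 2 L) : ℝ) = (L : ℝ) ^ 2 := by
    rw [Fintype.card_fun, ZMod.card, Fintype.card_fin]; push_cast; ring
  rw [hcard]
  ring_nf
  rfl

end Torus

end Literature.MathematicalPhysics.QuantumLattice
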